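import Mathlib.Data.Nat.Choose.Sum
import Mathlib.Data.Nat.Choose.Vandermonde
import Mathlib.Algebra.BigOperators.Intervals
import Mathlib.Algebra.BigOperators.Field
import Mathlib.Algebra.Order.BigOperators.Group.Finset
import Mathlib.Data.Real.Basic
import Mathlib.Tactic.FieldSimp
import Mathlib.Tactic.Linarith
import Mathlib.Tactic.Positivity
import Mathlib.Tactic.Ring
import HarnessLib

/-!
# Compatible triples of distributions with constant sum (Pebody 2018), I: explicit couplings

Topic `Literature/Combinatorics/Additive`; first of three support files formalising
L. Pebody, *Proof of a conjecture of Kleinberg–Sawin–Speyer* (Discrete Analysis 2018:13,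
arXiv:1608.05740), whose Theorem 4 is the large-deviation input (Theorem 4 of
Kleinberg–Sawin–Speyer 2018, "[Norin], [Pebody]") of the lower bound for tricolored sum-free sets
`Literature.Combinatorics.Additive.KleinbergSawinSpeyer2018_thm2`
(`TricoloredSumFreeLowerBound.lean`; proof in `TricoloredSumFreeLowerBoundProofs.lean`).

## Setting (cone form of Pebody's notions, p. 3 of the held text `paper:arxiv-1608.05740`)

Pebody calls three probability distributions `π₁, π₂, π₃` on `[p] = {0,…,p-1}` *compatible* if
there are dependent random variables `X₁, X₂, X₃` with these laws and `X₁ + X₂ + X₃ = p - 1`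
constant. We work with `m = p - 1` and drop the normalisation (the set of compatible triples is a
convex cone): a *coupling at level `m`* of three functions `π₁ π₂ π₃ : ℕ → ℝ` is a nonnegative
weight `w a b c` supported on `a + b + c = m` whose three marginals (double sums over
`range (m+1)`) are `π₁, π₂, π₃` (`IsCoupling`, `Coupled`). This file proves the closure
properties of `Coupled` (sums, nonnegative scalings, permutations of the roles) and the explicit
couplings of Pebody's §4–§5:

* `coupled_unif_unif_delta` — `(U_m, U_m, (m+1)·δ₀)` via `(X, m - X, 0)` (§5);
* `exists_uniform_coupling` — **Lemma 9**: `X` uniform on `[0,i]`, `Y` uniform on `[0,j]` with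
  `X + Y` uniform on `[0,i+j]`; we use the explicit law
  `ω(x,y) = C(x+y,x) C(i+j-x-y,i-x) / ((i+j+1) C(i+j,i))` of Pebody's interleaving construction,
  whose marginals come from the Chu–Vandermonde identities `sum_range_choose_mul_choose`
  (`Σ_k C(k,r)C(n-k,s) = C(n+1,r+s+1)`, proved here) and `Nat.add_choose_eq`;
* `coupled_cor10` — **Corollary 10**: `(U_i, U_m, V_{j,m,m-i})` for `i + j < m`, the third law
  written as `A·𝟙[0,j] + B·𝟙(j,m]` with `A = (i+j+1)/((m+1)(j+1))`, `B = (m-i-j)/((m+1)(m-j))`.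

Here `U_k = unif k = 𝟙[0,k]` is the unnormalised uniform profile. Part II is
`TricoloredSumFreeLowerBoundPeeling.lean` (profiles, admissible triples, Lemma 7, Corollary 8).
Pebody's Theorem 4 itself is `Pebody.theorem4` in `TricoloredSumFreeLowerBoundPebody.lean` (an
independent formalisation along Pebody's jump/charging decomposition, with local notations
`Adm[…]`/`Cpl[…]`, which discharges KSS Theorem 2 in `TricoloredSumFreeLowerBoundThm2.lean`);
`TricoloredSumFreeLowerBoundCompatible.lean` records it in the present named API
(`coupled_of_admissible : Admissible m π₁ π₂ π₃ → Coupled m π₁ π₂ π₃`, `exists_symmetric_coupling`),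
and the convexity step (Lemma 5 / Corollary 6) in cone form is the general
`Literature.Analysis.Convex.cone_induction` (`Literature/Analysis/Convex/ConeGeneration.lean`).

## References

* [Peabody2018] L. Pebody, *Proof of a conjecture of Kleinberg–Sawin–Speyer*, Discrete Analysis
  2018:13, arXiv:1608.05740 — §1 (compatible, Thm. 4), §4 Lemma 9, Cor. 10, §5.
* [KleinbergSawinSpeyer2018] R. Kleinberg, W. Sawin, D. E. Speyer, *The growth rate of
  tri-colored sum-free sets*, Discrete Analysis 2018:12 — Thm. 4.
-/

noncomputable section

open Finset

open scoped BigOperators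

namespace Literature.Combinatorics.Additive.Pebody

/-- `w` is a coupling at level `m` of the three profiles `π₁ π₂ π₃ : ℕ → ℝ`: a nonnegative weight
on triples `(a,b,c)` with `a+b+c = m` whose three marginals are `π₁, π₂, π₃`. [cite: Peabody2018, §1] -/
def IsCoupling (m : ℕ) (π₁ π₂ π₃ : ℕ → ℝ) (w : ℕ → ℕ → ℕ → ℝ) : Prop :=
  (∀ a b c, 0 ≤ w a b c) ∧ (∀ a b c, w a b c ≠ 0 → a + b + c = m) ∧
    (∀ a, ∑ b ∈ range (m + 1), ∑ c ∈ range (m + 1), w a b c = π₁ a) ∧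
    (∀ b, ∑ a ∈ range (m + 1), ∑ c ∈ range (m + 1), w a b c = π₂ b) ∧
    (∀ c, ∑ a ∈ range (m + 1), ∑ b ∈ range (m + 1), w a b c = π₃ c)

/-- The three profiles are *compatible* at level `m` (Pebody: "compatible"): some coupling exists.
[cite: Peabody2018, §1] -/
def Coupled (m : ℕ) (π₁ π₂ π₃ : ℕ → ℝ) : Prop :=
  ∃ w, IsCoupling m π₁ π₂ π₃ w

/-- The (unnormalised) uniform profile `U_k = 𝟙[0,k]`. [cite: Peabody2018, §2] -/
def unif (k : ℕ) : ℕ → ℝ := fun j => if j ≤ k then 1 else 0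

/-- Unfolding the uniform profile. [folklore] -/
theorem unif_apply (k j : ℕ) : unif k j = if j ≤ k then 1 else 0 := rfl

/-- Solving `a + b + c = m` for the middle variable inside a range sum. [folklore] -/
theorem sum_range_ite_add_eq (m a c : ℕ) (g : ℕ → ℝ) :
    (∑ b ∈ range (m + 1), if a + b + c = m then g b else 0) =
      if a + c ≤ m then g (m - a - c) else 0 := by
  split_ifs with h
  · rw [Finset.sum_eq_single (m - a - c)]
    · rw [if_pos (by omega)]
    · intro b _ hb
      rw [if_neg (by omega)]
    · intro hb
      exact absurd (Finset.mem_range.2 (by omega)) hb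
  · refine Finset.sum_eq_zero fun b _ => ?_
    rw [if_neg (by omega)]


/-- Solving `a + b + c = m` for the last variable inside a range sum. [folklore] -/
theorem sum_range_ite_add_eq_last (m a b : ℕ) (g : ℕ → ℝ) :
    (∑ c ∈ range (m + 1), if a + b + c = m then g c else 0) =
      if a + b ≤ m then g (m - a - b) else 0 := by
  split_ifs with h
  · rw [Finset.sum_eq_single (m - a - b)]
    · rw [if_pos (by omega)]
    · intro c _ hc
      rw [if_neg (by omega)]
    · intro hc
      exact absurd (Finset.mem_range.2 (by omega)) hc
  · refine Finset.sum_eq_zero fun c _ => ?_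
    rw [if_neg (by omega)]

/-- Restricting a range sum to the support. [folklore] -/
theorem sum_range_eq_sum_range_of_le {f : ℕ → ℝ} {K M : ℕ} (hKM : K ≤ M)
    (hf : ∀ k, K ≤ k → f k = 0) : ∑ k ∈ range M, f k = ∑ k ∈ range K, f k := by
  symm
  refine Finset.sum_subset (Finset.range_subset_range.2 hKM) fun k _ hk => hf k ?_
  simpa using hk

/-! ### Closure properties of `Coupled` -/

/-- The zero triple is coupled (by the zero weight). [folklore] -/
theorem coupled_zero (m : ℕ) : Coupled m 0 0 0 :=
  ⟨fun _ _ _ => 0, fun _ _ _ => le_rfl, fun _ _ _ h => (h rfl).elim, fun _ => by simp,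
    fun _ => by simp, fun _ => by simp⟩

/-- Sums of coupled triples are coupled. [cite: Peabody2018, §2] -/
theorem Coupled.add {m : ℕ} {π₁ π₂ π₃ π₁' π₂' π₃' : ℕ → ℝ} (h : Coupled m π₁ π₂ π₃)
    (h' : Coupled m π₁' π₂' π₃') : Coupled m (π₁ + π₁') (π₂ + π₂') (π₃ + π₃') := by
  obtain ⟨w, h0, hs, h1, h2, h3⟩ := h
  obtain ⟨w', h0', hs', h1', h2', h3'⟩ := h'
  refine ⟨fun a b c => w a b c + w' a b c, fun a b c => add_nonneg (h0 a b c) (h0' a b c),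
    fun a b c hne => ?_, fun a => ?_, fun b => ?_, fun c => ?_⟩
  · by_contra hm
    refine hne ?_
    show w a b c + w' a b c = 0
    rw [not_not.1 (mt (hs a b c) hm), not_not.1 (mt (hs' a b c) hm), add_zero]
  · simp only [Finset.sum_add_distrib, h1, h1', Pi.add_apply]
  · simp only [Finset.sum_add_distrib, h2, h2', Pi.add_apply]
  · simp only [Finset.sum_add_distrib, h3, h3', Pi.add_apply]

/-- Nonnegative multiples of coupled triples are coupled. [cite: Peabody2018, §2] -/
theorem Coupled.smul {m : ℕ} {π₁ π₂ π₃ : ℕ → ℝ} (h : Coupled m π₁ π₂ π₃) {t : ℝ} (ht : 0 ≤ t) :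
    Coupled m (fun k => t * π₁ k) (fun k => t * π₂ k) (fun k => t * π₃ k) := by
  obtain ⟨w, h0, hs, h1, h2, h3⟩ := h
  refine ⟨fun a b c => t * w a b c, fun a b c => mul_nonneg ht (h0 a b c),
    fun a b c hne => hs a b c fun h => hne (show t * w a b c = 0 by rw [h, mul_zero]),
    fun a => ?_, fun b => ?_, fun c => ?_⟩
  · simp only [← Finset.mul_sum, h1]
  · simp only [← Finset.mul_sum, h2]
  · simp only [← Finset.mul_sum, h3]

/-- Swapping the first two roles preserves compatibility. [folklore] -/
theorem Coupled.swap12 {m : ℕ} {π₁ π₂ π₃ : ℕ → ℝ} (h : Coupled m π₁ π₂ π₃) :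
    Coupled m π₂ π₁ π₃ := by
  obtain ⟨w, h0, hs, h1, h2, h3⟩ := h
  refine ⟨fun a b c => w b a c, fun a b c => h0 b a c, fun a b c hne => ?_, fun a => h2 a,
    fun b => h1 b, fun c => ?_⟩
  · have := hs b a c hne; omega
  · rw [Finset.sum_comm]; exact h3 c

/-- Swapping the last two roles preserves compatibility. [folklore] -/
theorem Coupled.swap23 {m : ℕ} {π₁ π₂ π₃ : ℕ → ℝ} (h : Coupled m π₁ π₂ π₃) :
    Coupled m π₁ π₃ π₂ := by
  obtain ⟨w, h0, hs, h1, h2, h3⟩ := h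
  refine ⟨fun a b c => w a c b, fun a b c => h0 a c b, fun a b c hne => ?_, fun a => ?_,
    fun b => h3 b, fun c => h2 c⟩
  · have := hs a c b hne; omega
  · rw [Finset.sum_comm]; exact h1 a

/-- Swapping the outer two roles preserves compatibility. [folklore] -/
theorem Coupled.swap13 {m : ℕ} {π₁ π₂ π₃ : ℕ → ℝ} (h : Coupled m π₁ π₂ π₃) :
    Coupled m π₃ π₂ π₁ :=
  h.swap12.swap23.swap12

/-- Cyclic rotation of the roles preserves compatibility. [folklore] -/
theorem Coupled.rotate {m : ℕ} {π₁ π₂ π₃ : ℕ → ℝ} (h : Coupled m π₁ π₂ π₃) :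
    Coupled m π₂ π₃ π₁ :=
  h.swap12.swap23

/-- A coupling vanishes off the simplex `a, b, c ≤ m`. [folklore] -/
theorem IsCoupling.eq_zero_of_lt {m : ℕ} {π₁ π₂ π₃ : ℕ → ℝ} {w : ℕ → ℕ → ℕ → ℝ}
    (h : IsCoupling m π₁ π₂ π₃ w) {a b c : ℕ} (habc : a + b + c ≠ m) : w a b c = 0 := by
  by_contra hne
  exact habc (h.2.1 a b c hne)

/-- The marginals of a coupling vanish above `m`. [folklore] -/
theorem IsCoupling.apply_eq_zero {m : ℕ} {π₁ π₂ π₃ : ℕ → ℝ} {w : ℕ → ℕ → ℕ → ℝ}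
    (h : IsCoupling m π₁ π₂ π₃ w) {a : ℕ} (ha : m < a) : π₁ a = 0 := by
  rw [← h.2.2.1 a]
  exact Finset.sum_eq_zero fun b _ => Finset.sum_eq_zero fun c _ => h.eq_zero_of_lt (by omega)

/-! ### The first explicit coupling: `(U_m, U_m, (m+1) δ₀)` -/

/-- `X` uniform on `[0,m]`, `Y = m - X`, `Z = 0` couples `(U_m, U_m, (m+1)·U_0)`
(Pebody, §5: "let `X₁ = 0`, `X₂` be uniform on `[p]` and let `X₃ = (p-1) - X₂`").
[cite: Peabody2018, §5] -/
theorem coupled_unif_unif_delta (m : ℕ) :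
    Coupled m (unif m) (unif m) (fun k => (m + 1 : ℝ) * unif 0 k) := by
  refine ⟨fun a b c => if a + b = m ∧ c = 0 then 1 else 0, fun a b c => by positivity,
    fun a b c hne => ?_, fun a => ?_, fun b => ?_, fun c => ?_⟩
  · by_contra h
    exact hne (if_neg fun h' => h (by omega))
  · rw [Finset.sum_comm, Finset.sum_eq_single 0]
    · simp only [and_true, unif_apply]
      split_ifs with ha
      · rw [Finset.sum_eq_single (m - a)]
        · rw [if_pos (by omega)]
        · intro b _ hb; rw [if_neg (by omega)]
        · intro hb; exact absurd (Finset.mem_range.2 (by omega)) hb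
      · exact Finset.sum_eq_zero fun b _ => if_neg (by omega)
    · intro c _ hc
      exact Finset.sum_eq_zero fun b _ => if_neg fun h => hc h.2
    · intro h; exact absurd (by simp) h
  · rw [Finset.sum_comm, Finset.sum_eq_single 0]
    · simp only [and_true, unif_apply]
      split_ifs with hb
      · rw [Finset.sum_eq_single (m - b)]
        · rw [if_pos (by omega)]
        · intro a _ ha; rw [if_neg (by omega)]
        · intro ha; exact absurd (Finset.mem_range.2 (by omega)) ha
      · exact Finset.sum_eq_zero fun a _ => if_neg (by omega)
    · intro c _ hc
      exact Finset.sum_eq_zero fun a _ => if_neg fun h => hc h.2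
    · intro h; exact absurd (by simp) h
  · simp only [unif_apply, Nat.le_zero]
    split_ifs with hc
    · subst hc
      simp only [and_true, mul_one]
      have : ∀ a ∈ range (m + 1), (∑ b ∈ range (m + 1), if a + b = m then (1 : ℝ) else 0) = 1 := by
        intro a ha
        rw [Finset.sum_eq_single (m - a)]
        · rw [if_pos (by simp at ha; omega)]
        · intro b _ hb; rw [if_neg (by omega)]
        · intro hb; exact absurd (Finset.mem_range.2 (by omega)) hb
      rw [Finset.sum_congr rfl this]
      simp
    · rw [mul_zero]
      exact Finset.sum_eq_zero fun a _ => Finset.sum_eq_zero fun b _ => if_neg fun h => hc h.2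


/-! ### Pebody's Lemma 9: uniform `X`, `Y` with uniform `X + Y` -/

/-- The "upper" Chu–Vandermonde identity `Σ_{k ≤ n} C(k,r) C(n-k,s) = C(n+1, r+s+1)`. [folklore] -/
theorem sum_range_choose_mul_choose (n r s : ℕ) :
    ∑ k ∈ range (n + 1), k.choose r * (n - k).choose s = (n + 1).choose (r + s + 1) := by
  induction n generalizing s with
  | zero =>
    rw [Finset.sum_range_one, Nat.sub_zero]
    rcases r with _ | r
    · rcases s with _ | s
      · simp
      · rw [Nat.choose_zero_succ, mul_zero, Nat.choose_eq_zero_of_lt (by omega)]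
    · rw [Nat.choose_zero_succ, zero_mul, Nat.choose_eq_zero_of_lt (by omega)]
  | succ n ih =>
    rw [Finset.sum_range_succ, Nat.sub_self]
    rcases s with _ | s
    · have ih0 := ih 0
      simp only [Nat.choose_zero_right, mul_one] at ih0 ⊢
      rw [ih0, add_zero, Nat.choose_succ_succ' (n + 1) r, add_comm]
    · rw [Nat.choose_zero_succ, mul_zero, add_zero]
      have hsplit : ∀ k ∈ range (n + 1), k.choose r * (n + 1 - k).choose (s + 1) =
          k.choose r * (n - k).choose s + k.choose r * (n - k).choose (s + 1) := by
        intro k hk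
        rw [Finset.mem_range] at hk
        rw [show n + 1 - k = (n - k) + 1 by omega, Nat.choose_succ_succ', mul_add]
      rw [Finset.sum_congr rfl hsplit, Finset.sum_add_distrib, ih s, ih (s + 1),
        show r + (s + 1) + 1 = (r + s + 1) + 1 by ring, Nat.choose_succ_succ' (n + 1) (r + s + 1)]

/-- Reindexing `k = x + y` in the upper Chu–Vandermonde sum. [folklore] -/
theorem sum_range_choose_mul_choose_shift (i j x : ℕ) (hx : x ≤ i) :
    ∑ k ∈ range (i + j + 1), k.choose x * (i + j - k).choose (i - x) =
      ∑ y ∈ range (j + 1), (x + y).choose x * (i + j - x - y).choose (i - x) := by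
  rw [← Finset.sum_range_add_sum_Ico _ (show x ≤ i + j + 1 by omega)]
  have h0 : ∑ k ∈ range x, k.choose x * (i + j - k).choose (i - x) = 0 :=
    Finset.sum_eq_zero fun k hk => by
      rw [Finset.mem_range] at hk
      rw [Nat.choose_eq_zero_of_lt hk, zero_mul]
  rw [h0, zero_add, Finset.sum_Ico_eq_sum_range, show i + j + 1 - x = (j + 1) + (i - x) by omega,
    ← Finset.sum_range_add_sum_Ico _ (Nat.le_add_right (j + 1) (i - x))]
  have h1 : ∑ k ∈ Ico (j + 1) (j + 1 + (i - x)),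
      (x + k).choose x * (i + j - (x + k)).choose (i - x) = 0 :=
    Finset.sum_eq_zero fun k hk => by
      rw [Finset.mem_Ico] at hk
      rw [Nat.choose_eq_zero_of_lt (show i + j - (x + k) < i - x by omega), mul_zero]
  rw [h1, add_zero]
  refine Finset.sum_congr rfl fun y _ => ?_
  rw [show i + j - (x + y) = i + j - x - y by omega]

/-- **Pebody's Lemma 9** (uniform `X` on `[0,i]` and `Y` on `[0,j]` coupled so that `X + Y` is
uniform on `[0,i+j]`), as an explicit weight: `ω(x,y) = C(x+y,x) C(i+j-x-y,i-x)/((i+j+1) C(i+j,i))`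
(the law of the numbers of `A`'s and `B`'s preceding `C` in a uniformly random arrangement of
`i` letters `A`, `j` letters `B` and one `C`, which is Pebody's proof). [cite: Peabody2018, Lemma 9] -/
theorem exists_uniform_coupling (i j : ℕ) :
    ∃ ω : ℕ → ℕ → ℝ, (∀ x y, 0 ≤ ω x y) ∧ (∀ x y, ω x y ≠ 0 → x ≤ i ∧ y ≤ j) ∧
      (∀ x, ∑ y ∈ range (j + 1), ω x y = if x ≤ i then 1 / (i + 1 : ℝ) else 0) ∧
      (∀ y, ∑ x ∈ range (i + 1), ω x y = if y ≤ j then 1 / (j + 1 : ℝ) else 0) ∧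
      (∀ s, s ≤ i + j → ∑ x ∈ range (i + 1), ∑ y ∈ range (j + 1),
        (if x + y = s then ω x y else 0) = 1 / (i + j + 1 : ℝ)) := by
  set D : ℝ := (i + j + 1 : ℝ) * ((i + j).choose i : ℝ) with hD
  have hDpos : 0 < D := by
    have : 0 < (i + j).choose i := Nat.choose_pos (by omega)
    positivity
  -- the normalising identities
  have hDi : ((i + j + 1).choose (i + 1) : ℝ) / D = 1 / (i + 1 : ℝ) := by
    have h := Nat.add_one_mul_choose_eq (i + j) i
    rw [div_eq_div_iff hDpos.ne' (by positivity), one_mul, hD]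
    exact_mod_cast h.symm
  have hDj : ((i + j + 1).choose (j + 1) : ℝ) / D = 1 / (j + 1 : ℝ) := by
    have h := Nat.add_one_mul_choose_eq (i + j) j
    rw [Nat.choose_symm_of_eq_add (show i + j = j + i by omega)] at h
    rw [div_eq_div_iff hDpos.ne' (by positivity), one_mul, hD]
    exact_mod_cast h.symm
  refine ⟨fun x y => if x ≤ i ∧ y ≤ j then
      ((x + y).choose x * (i + j - x - y).choose (i - x) : ℝ) / D else 0,
    fun x y => by positivity, fun x y h => ?_, fun x => ?_, fun y => ?_, fun s hs => ?_⟩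
  · by_contra hxy
    exact h (if_neg hxy)
  · -- first marginal
    dsimp only
    split_ifs with hx
    · have key := sum_range_choose_mul_choose (i + j) x (i - x)
      rw [show x + (i - x) + 1 = i + 1 by omega, sum_range_choose_mul_choose_shift i j x hx] at key
      rw [← hDi, ← key]
      push_cast
      rw [Finset.sum_div]
      refine Finset.sum_congr rfl fun y hy => ?_
      rw [Finset.mem_range] at hy
      rw [if_pos ⟨hx, by omega⟩]
    · exact Finset.sum_eq_zero fun y _ => if_neg fun h => hx h.1
  · -- second marginal (symmetric)
    dsimp only
    split_ifs with hy
    · have key := sum_range_choose_mul_choose (j + i) y (j - y)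
      rw [show y + (j - y) + 1 = j + 1 by omega, sum_range_choose_mul_choose_shift j i y hy,
        show j + i = i + j by ring] at key
      rw [← hDj, ← key]
      push_cast
      rw [Finset.sum_div]
      refine Finset.sum_congr rfl fun x hx => ?_
      rw [Finset.mem_range] at hx
      rw [if_pos ⟨by omega, hy⟩, show y + x = x + y by ring,
        show i + j - y - x = i + j - x - y by omega,
        Nat.choose_symm_of_eq_add (rfl : x + y = x + y),
        Nat.choose_symm_of_eq_add (show i + j - x - y = (i - x) + (j - y) by omega)]
    · exact Finset.sum_eq_zero fun x _ => if_neg fun h => hy h.2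
  · -- the sum `X + Y`
    dsimp only
    have hV := Nat.add_choose_eq s (i + j - s) i
    rw [show s + (i + j - s) = i + j by omega, Finset.Nat.sum_antidiagonal_eq_sum_range_succ
      (fun a b => s.choose a * (i + j - s).choose b) i] at hV
    have hin : ∀ x ∈ range (i + 1), (∑ y ∈ range (j + 1),
        (if x + y = s then (if x ≤ i ∧ y ≤ j then
          (((x + y).choose x : ℕ) : ℝ) * (((i + j - x - y).choose (i - x) : ℕ) : ℝ) / D
          else 0) else 0)) =
        ((s.choose x : ℕ) : ℝ) * (((i + j - s).choose (i - x) : ℕ) : ℝ) / D := by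
      intro x hx
      rw [Finset.mem_range] at hx
      by_cases hxs : s < x
      · rw [Nat.choose_eq_zero_of_lt hxs, Nat.cast_zero, zero_mul, zero_div]
        exact Finset.sum_eq_zero fun y _ => if_neg (by omega)
      by_cases hys : j < s - x
      · rw [Nat.choose_eq_zero_of_lt (show i + j - s < i - x by omega), Nat.cast_zero, mul_zero,
          zero_div]
        refine Finset.sum_eq_zero fun y hy => ?_
        rw [Finset.mem_range] at hy
        exact if_neg (by omega)
      rw [Finset.sum_eq_single (s - x)]
      · rw [if_pos (by omega), if_pos ⟨by omega, by omega⟩, show x + (s - x) = s by omega,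
          show i + j - x - (s - x) = i + j - s by omega]
      · intro y _ hy
        exact if_neg (by omega)
      · intro h
        exact absurd (Finset.mem_range.2 (by omega)) h
    rw [Finset.sum_congr rfl hin, ← Finset.sum_div, div_eq_div_iff hDpos.ne' (by positivity),
      one_mul, hD]
    have hV' : (∑ x ∈ range (i + 1), ((s.choose x : ℕ) : ℝ) * (((i + j - s).choose (i - x) : ℕ) : ℝ))
        = (((i + j).choose i : ℕ) : ℝ) := by exact_mod_cast hV.symm
    rw [hV']
    ring


/-! ### Pebody's Corollary 10: `(U_i, U_m, V_{j,m,m-i})` -/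

/-- **Pebody's Corollary 10.** For `i ≥ 1`, `j ≥ 0`, `i + j < m`, the uniform distribution on
`[0,i]`, the uniform distribution on `[0,m]` and the mixture of the uniform distributions on `[0,j]`
(weight `(i+j+1)/(m+1)`) and on `[j+1,m]` (weight `(m-i-j)/(m+1)`) are compatible: with
probability `(i+j+1)/(m+1)` take `(X, m-X-Y, Y)` with `X, Y, X+Y` uniform on `[0,i], [0,j],
[0,i+j]` (Lemma 9), otherwise `(X', Y', m-X'-Y')` with `X', Y', X'+Y'` uniform on
`[0,i], [0,m-i-j-1], [0,m-j-1]`. [cite: Peabody2018, Corollary 10] -/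
theorem coupled_cor10 {m i j : ℕ} (hij : i + j < m) :
    Coupled m (fun a => unif i a / (i + 1 : ℝ)) (fun b => unif m b / (m + 1 : ℝ))
      (fun c => (i + j + 1 : ℝ) / ((m + 1 : ℝ) * (j + 1 : ℝ)) * unif j c +
        ((m - i - j : ℕ) : ℝ) / ((m + 1 : ℝ) * ((m - j : ℕ) : ℝ)) * (unif m c - unif j c)) := by
  obtain ⟨ω, hω0, hωs, hω1, hω2, hω3⟩ := exists_uniform_coupling i j
  obtain ⟨ω', hω0', hωs', hω1', hω2', hω3'⟩ := exists_uniform_coupling i (m - i - j - 1)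
  have hL1 : ((m - i - j - 1 : ℕ) : ℝ) + 1 = ((m - i - j : ℕ) : ℝ) := by
    rw [← Nat.cast_add_one, show m - i - j - 1 + 1 = m - i - j by omega]
  have hL2 : (i : ℝ) + ((m - i - j - 1 : ℕ) : ℝ) + 1 = ((m - j : ℕ) : ℝ) := by
    have : i + (m - i - j - 1) + 1 = m - j := by omega
    exact_mod_cast this
  set PH : ℝ := (i + j + 1 : ℝ) / (m + 1 : ℝ) with hPH
  set PT : ℝ := ((m - i - j : ℕ) : ℝ) / (m + 1 : ℝ) with hPT
  have hPH0 : 0 ≤ PH := by positivity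
  have hPT0 : 0 ≤ PT := by positivity
  have hPHT : PH + PT = 1 := by
    rw [hPH, hPT, ← add_div, div_eq_one_iff_eq (by positivity)]
    have : i + j + 1 + (m - i - j) = m + 1 := by omega
    exact_mod_cast this
  -- support consequences
  have hωz : ∀ a c, ¬(a ≤ i ∧ c ≤ j) → ω a c = 0 := fun a c h => by
    by_contra hne; exact h (hωs a c hne)
  have hωz' : ∀ a b, ¬(a ≤ i ∧ b ≤ m - i - j - 1) → ω' a b = 0 := fun a b h => by
    by_contra hne; exact h (hωs' a b hne)
  refine ⟨fun a b c => (if a + b + c = m then PH * ω a c else 0) +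
      (if a + b + c = m then PT * ω' a b else 0), fun a b c => ?_, fun a b c hne => ?_,
    fun a => ?_, fun b => ?_, fun c => ?_⟩
  · have := hω0 a c; have := hω0' a b; positivity
  · by_contra h
    dsimp only at hne
    rw [if_neg h, if_neg h, add_zero] at hne
    exact hne rfl
  · -- first marginal
    dsimp only
    simp only [Finset.sum_add_distrib]
    have h1 : ∑ b ∈ range (m + 1), ∑ c ∈ range (m + 1), (if a + b + c = m then PH * ω a c else 0)
        = PH * (unif i a / (i + 1 : ℝ)) := by
      rw [Finset.sum_comm]
      simp_rw [sum_range_ite_add_eq m a _ (fun _ => PH * ω a _)]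
      have : ∀ c ∈ range (m + 1), (if a + c ≤ m then PH * ω a c else 0) = PH * ω a c := by
        intro c _
        split_ifs with h
        · rfl
        · rw [hωz a c (by omega), mul_zero]
      rw [Finset.sum_congr rfl this, ← Finset.mul_sum,
        sum_range_eq_sum_range_of_le (show j + 1 ≤ m + 1 by omega)
          (fun c hc => hωz a c (by omega)), hω1 a, unif_apply]
      split_ifs <;> simp
    have h2 : ∑ b ∈ range (m + 1), ∑ c ∈ range (m + 1), (if a + b + c = m then PT * ω' a b else 0)
        = PT * (unif i a / (i + 1 : ℝ)) := by
      simp_rw [sum_range_ite_add_eq_last m a _ (fun _ => PT * ω' a _)]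
      have : ∀ b ∈ range (m + 1), (if a + b ≤ m then PT * ω' a b else 0) = PT * ω' a b := by
        intro b _
        split_ifs with h
        · rfl
        · rw [hωz' a b (by omega), mul_zero]
      rw [Finset.sum_congr rfl this, ← Finset.mul_sum,
        sum_range_eq_sum_range_of_le (show m - i - j - 1 + 1 ≤ m + 1 by omega)
          (fun b hb => hωz' a b (by omega)), hω1' a, unif_apply]
      split_ifs <;> simp
    rw [h1, h2, ← add_mul, hPHT, one_mul]
  · -- second marginal
    dsimp only
    simp only [Finset.sum_add_distrib]
    have h1 : ∑ a ∈ range (m + 1), ∑ c ∈ range (m + 1), (if a + b + c = m then PH * ω a c else 0)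
        = if m - i - j ≤ b ∧ b ≤ m then PH / (i + j + 1 : ℝ) else 0 := by
      by_cases hb : b ≤ m
      · have : ∀ a ∈ range (m + 1), ∑ c ∈ range (m + 1), (if a + b + c = m then PH * ω a c else 0)
            = ∑ c ∈ range (j + 1), (if a + c = m - b then PH * ω a c else 0) := by
          intro a _
          rw [sum_range_eq_sum_range_of_le (show j + 1 ≤ m + 1 by omega)]
          · refine Finset.sum_congr rfl fun c _ => ?_
            exact if_congr (by omega) rfl rfl
          · intro c hc
            rw [hωz a c (by omega), mul_zero, ite_self]
        rw [Finset.sum_congr rfl this, sum_range_eq_sum_range_of_le (show i + 1 ≤ m + 1 by omega)]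
        · split_ifs with hb'
          · rw [div_eq_mul_one_div, ← hω3 (m - b) (by omega), Finset.mul_sum]
            refine Finset.sum_congr rfl fun a _ => ?_
            rw [Finset.mul_sum]
            refine Finset.sum_congr rfl fun c _ => ?_
            split_ifs <;> simp
          · refine Finset.sum_eq_zero fun a ha => Finset.sum_eq_zero fun c hc => ?_
            rw [Finset.mem_range] at ha hc
            exact if_neg (by omega)
        · intro a ha
          exact Finset.sum_eq_zero fun c _ => by rw [hωz a c (by omega), mul_zero, ite_self]
      · rw [if_neg (by omega)]
        refine Finset.sum_eq_zero fun a _ => Finset.sum_eq_zero fun c _ => if_neg (by omega)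
    have h2 : ∑ a ∈ range (m + 1), ∑ c ∈ range (m + 1), (if a + b + c = m then PT * ω' a b else 0)
        = if b ≤ m - i - j - 1 then PT / ((m - i - j - 1 : ℕ) + 1 : ℝ) else 0 := by
      simp_rw [sum_range_ite_add_eq_last m _ b (fun _ => PT * ω' _ b)]
      have : ∀ a ∈ range (m + 1), (if a + b ≤ m then PT * ω' a b else 0) = PT * ω' a b := by
        intro a _
        split_ifs with h
        · rfl
        · rw [hωz' a b (by omega), mul_zero]
      rw [Finset.sum_congr rfl this, ← Finset.mul_sum,
        sum_range_eq_sum_range_of_le (show i + 1 ≤ m + 1 by omega)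
          (fun a ha => hωz' a b (by omega)), hω2' b]
      split_ifs <;> simp [div_eq_mul_inv]
    rw [h1, h2, unif_apply, hL1, hPH, hPT]
    by_cases hb : b ≤ m
    · rw [if_pos hb]
      by_cases hb' : m - i - j ≤ b
      · rw [if_pos ⟨hb', hb⟩, if_neg (by omega), add_zero, div_div,
          mul_comm ((m : ℝ) + 1), ← div_div, div_self (by positivity)]
      · rw [if_neg (fun h => hb' h.1), if_pos (by omega), zero_add, div_div,
          mul_comm ((m : ℝ) + 1), ← div_div, div_self]
        have : 0 < m - i - j := by omega
        positivity
    · rw [if_neg hb, if_neg (fun h => hb h.2), if_neg (by omega), zero_add, zero_div]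
  · -- third marginal
    dsimp only
    simp only [Finset.sum_add_distrib]
    have h1 : ∑ a ∈ range (m + 1), ∑ b ∈ range (m + 1), (if a + b + c = m then PH * ω a c else 0)
        = PH * (unif j c / (j + 1 : ℝ)) := by
      simp_rw [sum_range_ite_add_eq m _ c (fun _ => PH * ω _ c)]
      have : ∀ a ∈ range (m + 1), (if a + c ≤ m then PH * ω a c else 0) = PH * ω a c := by
        intro a _
        split_ifs with h
        · rfl
        · rw [hωz a c (by omega), mul_zero]
      rw [Finset.sum_congr rfl this, ← Finset.mul_sum,
        sum_range_eq_sum_range_of_le (show i + 1 ≤ m + 1 by omega)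
          (fun a ha => hωz a c (by omega)), hω2 c, unif_apply]
      split_ifs <;> simp
    have h2 : ∑ a ∈ range (m + 1), ∑ b ∈ range (m + 1), (if a + b + c = m then PT * ω' a b else 0)
        = if j + 1 ≤ c ∧ c ≤ m then PT / ((m - j : ℕ) : ℝ) else 0 := by
      by_cases hc : c ≤ m
      · have : ∀ a ∈ range (m + 1), ∑ b ∈ range (m + 1), (if a + b + c = m then PT * ω' a b else 0)
            = ∑ b ∈ range (m - i - j - 1 + 1), (if a + b = m - c then PT * ω' a b else 0) := by
          intro a _
          rw [sum_range_eq_sum_range_of_le (show m - i - j - 1 + 1 ≤ m + 1 by omega)]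
          · refine Finset.sum_congr rfl fun b _ => ?_
            exact if_congr (by omega) rfl rfl
          · intro b hb
            rw [hωz' a b (by omega), mul_zero, ite_self]
        rw [Finset.sum_congr rfl this, sum_range_eq_sum_range_of_le (show i + 1 ≤ m + 1 by omega)]
        · split_ifs with hc'
          · rw [div_eq_mul_one_div, ← hL2, ← hω3' (m - c) (by omega), Finset.mul_sum]
            refine Finset.sum_congr rfl fun a _ => ?_
            rw [Finset.mul_sum]
            refine Finset.sum_congr rfl fun b _ => ?_
            split_ifs <;> simp
          · refine Finset.sum_eq_zero fun a ha => Finset.sum_eq_zero fun b hb => ?_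
            rw [Finset.mem_range] at ha hb
            refine if_neg fun hab => ?_
            have := hωz' a b
            by_cases hs : a ≤ i ∧ b ≤ m - i - j - 1
            · omega
            · omega
        · intro a ha
          exact Finset.sum_eq_zero fun b _ => by rw [hωz' a b (by omega), mul_zero, ite_self]
      · rw [if_neg (by omega)]
        refine Finset.sum_eq_zero fun a _ => Finset.sum_eq_zero fun b _ => if_neg (by omega)
    have hmj0 : ((m - j : ℕ) : ℝ) ≠ 0 := (Nat.cast_pos.2 (by omega)).ne'
    rw [h1, h2, unif_apply, unif_apply, hPH, hPT]
    by_cases hc : c ≤ j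
    · rw [if_pos hc, if_pos (show c ≤ m by omega), if_neg (by omega), sub_self, mul_zero, add_zero,
        add_zero]
      field_simp
    · rw [if_neg hc]
      by_cases hc' : c ≤ m
      · rw [if_pos hc', if_pos ⟨by omega, hc'⟩]
        field_simp
        ring
      · rw [if_neg hc', if_neg (fun h => hc' h.2)]
        ring

end Literature.Combinatorics.Additive.Pebody
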